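import Summits.AtomisticToContinuum.HydrodynamicLimit.Theorems.InformationPercolationEngineChaosClosesEulerShellFieldC
import Summits.AtomisticToContinuum.HydrodynamicLimit.Theorems.InformationPercolationEngineChaosClosesEulerShellGlue
import HarnessLib

/-!
# BF18 shell for functions (crux `ChaosClosesEuler`, stmt-AtomisticToContinuum-15141, line `Sketch`,
# stub `stub_bf18Shell`) — assembly core lemma A: the slice functional (`stub_bf18ShellCoreA`)

WHAT. The setting of the deterministic Březina–Feireisl relative-energy shell of the line: the equation of
state `eos = EulerEOS.monatomicExcess χe f`, a classical solution `(ρ, u, θ)` on `[0, T)`, horizons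
`0 < t < t' < T` with data bounds `M` (point data), `N` (`CoeffBound`) and field bounds `|ρ|, ‖u‖, |θ| ≤ P`
(`P ≥ 1`) on `[0, t']`, a compact range `K ∋ (ρ, θ)`, the pointwise package of the shell (of which only the sign
`0 ≤ ℰ` is used here), a measurable bounded shell field `V = (ϱ, m, E)` (`ϱ, E ≥ 0`, `|m|² ≤ 2ϱE`), a defect
`0 ≤ δ ≤ 1`, the shell hypotheses (H1) (continuity against `C¹` tests), (H4) (energy), (H5) (uniform closeness
at time `0`), and the initial-smallness clause of `…ShellInit` at tolerance `η ≥ δ` and level `κ`. With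
`ℰ(s, x)` the clamped relative energy of the shell state `w(V s x) = (ϱ, E - |m|²/(2ϱ), m)` against the point
data `pdAt T ρ u θ (s, x)` (cold/warm selected cut-off) and `F(s) = ∫ₓ ℰ(s, x)`, the theorem `coreA` says:
there is a measurable `Fm` with `Fm = F` on `[0, t]`, `0 ≤ Fm ≤ C₂` on `[0, t]` where
`C₂ = (1 + 3M)(P(P²/2 + 3P/2) + 2) + (3M + N + N·max|a||b|)(P + 1) + N`, and `Fm 0 ≤ κ`.

PROOF. `Fm` is the measurable version of `…ShellFieldC.exists_measurable_relEnergy` (stated on `[0, t']`);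
the sign is the pointwise sign of the package integrated; the universal bound follows from the splitting
`F = ∫E - ∫ũ·m + ∫φ₁ϱ - ∫θ̃ϱZs + ∫p̃` (`integral_relEnergy_split`) and the elementary bounds
`∫E(s) ≤ ∫E(0) + δ ≤ P(P²/2 + 3P/2) + 2` ((H4), (H5)), `|ũ·m| ≤ 3M(ϱ + E)`, `|φ₁ϱ| ≤ Nϱ`,
`|θ̃ϱZs| ≤ N max|a||b| ϱ`, `|p̃| ≤ N`, `∫ϱ(s) = ∫ϱ(0) ≤ P + 1` (mass conservation `stub_bf18ShellGlue`, (H5));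
the initial value is the initial-smallness clause applied pointwise at time `0` (the selector picks the clamp
since the state temperature `2E/(3ϱ)` is positive there), integrated over the torus (a probability space).

WHY. Part A of the final assembly of `stub_bf18Shell`: the functional fed to the weighted bookkeeping
(`coreB`) and the windowed Grönwall lemma, with its a-priori level `C₂` and its initial value.

No named fact is invoked.
-/

noncomputable section

namespace Summit.AtomisticToContinuum.HydrodynamicLimit.Theorems.ChaosClosesEulerShellCoreA

open Set MeasureTheory Function
open scoped InnerProductSpace BigOperators
open Literature.MathematicalPhysics.KineticTheory (T3 V3 totalEnergyDensity)
open Literature.Analysis.FluidPDE Literature.Analysis.FluidPDE.CompressibleEuler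
open Literature.Analysis.FluidPDE.CompressibleEuler.StrongPointData
open Literature.Analysis.FunctionSpaces

/-! ## Elementary arithmetic of the universal bound -/

/-- The bookkeeping of the universal bound: from `|XI| ≤ 3M(Xr + XE)`, `|XT| ≤ N Xr`, `|XZ| ≤ N Zb Xr`,
`|XP| ≤ N`, `XE ≤ B₁`, `Xr ≤ P + 1` (and `M, N, Zb ≥ 0`),
`XE - XI + XT - XZ + XP ≤ (1 + 3M) B₁ + (3M + N + N Zb)(P + 1) + N`. [folklore] -/
theorem split_bound {M N P Zb XE XI XT XZ XP Xr B₁ : ℝ} (hM : 0 ≤ M) (hN : 0 ≤ N) (hZb : 0 ≤ Zb)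
    (hI : |XI| ≤ 3 * M * (Xr + XE)) (hT : |XT| ≤ N * Xr)
    (hZ : |XZ| ≤ N * Zb * Xr) (hP : |XP| ≤ N) (hE : XE ≤ B₁) (hr : Xr ≤ P + 1) :
    XE - XI + XT - XZ + XP ≤ (1 + 3 * M) * B₁ + (3 * M + N + N * Zb) * (P + 1) + N := by
  have hI' := abs_le.1 hI
  have hT' := abs_le.1 hT
  have hZ' := abs_le.1 hZ
  have hP' := abs_le.1 hP
  have h1 : (1 + 3 * M) * XE ≤ (1 + 3 * M) * B₁ := mul_le_mul_of_nonneg_left hE (by positivity)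
  have h2 : (3 * M + N + N * Zb) * Xr ≤ (3 * M + N + N * Zb) * (P + 1) :=
    mul_le_mul_of_nonneg_left hr (by positivity)
  nlinarith

/-- The total energy density `ρ(‖u‖²/2 + 3θ/2)` of fields with `0 ≤ ρ ≤ P`, `‖u‖ ≤ P`, `0 ≤ θ ≤ P` is at most
`P(P²/2 + 3P/2)`. [folklore] -/
theorem totalEnergyDensity_le {r Θ P : ℝ} {w : V3} (hr0 : 0 ≤ r) (hrP : r ≤ P) (hw : ‖w‖ ≤ P) (hΘ0 : 0 ≤ Θ)
    (hΘP : Θ ≤ P) : totalEnergyDensity r w Θ ≤ P * (P ^ 2 / 2 + 3 / 2 * P) := by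
  have hP0 : 0 ≤ P := hr0.trans hrP
  unfold totalEnergyDensity
  refine mul_le_mul hrP (add_le_add ?_ ?_) (by positivity) hP0
  · exact div_le_div_of_nonneg_right (pow_le_pow_left₀ (norm_nonneg _) hw 2) two_pos.le
  · exact mul_le_mul_of_nonneg_left hΘP (by norm_num)

/-- On the torus (a probability space), a real function bounded by `C` in norm has `∫ ≤ C`. [folklore] -/
theorem integral_le_of_norm_le {g : T3 → ℝ} {C : ℝ} (h : ∀ x, ‖g x‖ ≤ C) : ∫ x, g x ≤ C := by
  have key := norm_integral_le_of_norm_le_const (μ := (volume : Measure T3)) (Filter.Eventually.of_forall h)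
  rw [probReal_univ, mul_one, Real.norm_eq_abs] at key
  exact (le_abs_self _).trans key

/-- On the torus, `|∫ g| ≤ C` for a real function bounded by `C` in norm. [folklore] -/
theorem abs_integral_le_of_norm_le {g : T3 → ℝ} {C : ℝ} (h : ∀ x, ‖g x‖ ≤ C) : |∫ x, g x| ≤ C := by
  have key := norm_integral_le_of_norm_le_const (μ := (volume : Measure T3)) (Filter.Eventually.of_forall h)
  rwa [probReal_univ, mul_one, Real.norm_eq_abs] at key

/-- `|∫ g| ≤ c ∫ h` when `‖g‖ ≤ c h` pointwise and `h` is integrable. [folklore] -/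
theorem abs_integral_le_const_mul {g h : T3 → ℝ} {c : ℝ} (hh : Integrable h) (hle : ∀ x, ‖g x‖ ≤ c * h x) :
    |∫ x, g x| ≤ c * ∫ x, h x := by
  have key := norm_integral_le_of_norm_le (hh.const_mul c) (Filter.Eventually.of_forall hle)
  rwa [integral_const_mul, Real.norm_eq_abs] at key

/-! ## The core lemma -/

set_option maxHeartbeats 1600000 in
/-- **Core lemma A of the BF18 shell assembly: the slice functional.** In the setting of the shell (see the
module docstring), the space integral `F(s) = ∫ₓ ℰ(s, x)` of the clamped relative energy of the shell state
against the classical point data has a measurable version `Fm` on `[0, t]` with `0 ≤ Fm ≤ C₂` on `[0, t]`,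
`C₂ = (1 + 3M)(P(P²/2 + 3P/2) + 2) + (3M + N + N·max|a||b|)(P + 1) + N`, and `Fm 0 ≤ κ`.
[cite: BrezinaFeireisl2018, §3] -/
theorem coreA {χe f : ℝ → ℝ} {B : ℝ} (hχc : ContinuousOn χe (Set.Ioi 0)) (hfc : ContinuousOn f (Set.Ioi 0)) (hB : ∀ a, 0 < a → |χe a| ≤ B)
    {T : ℝ} {ρ θ : ℝ → T3 → ℝ} {u : ℝ → T3 → V3}
    (hcl : IsClassicalEulerSolution (EulerEOS.monatomicExcess χe f) T ρ u θ) (hG : (EulerEOS.monatomicExcess χe f).IsGibbs)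
    {t t' : ℝ} (ht0 : 0 < t) (htt' : t < t') (ht'T : t' < T)
    {M N : ℝ} (hM0 : 0 ≤ M) (hN0 : 0 ≤ N) (hM : ∀ s ∈ Set.Icc 0 t', ∀ x, (pdAt T ρ u θ (s, x)).Bounded M)
    (hN : CoeffBound (EulerEOS.monatomicExcess χe f) T ρ u θ t' N)
    {K : Set (ℝ × ℝ)} (hmemK : ∀ s ∈ Set.Icc 0 t', ∀ x, (ρ s x, θ s x) ∈ K)
    {P : ℝ} (hP1 : 1 ≤ P) (hρb : ∀ s ∈ Set.Icc 0 t', ∀ x, |ρ s x| ≤ P) (hub : ∀ s ∈ Set.Icc 0 t', ∀ x, ‖u s x‖ ≤ P)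
    (hθb : ∀ s ∈ Set.Icc 0 t', ∀ x, |θ s x| ≤ P)
    {δK a b C c : ℝ} (hδK : 0 < δK) (hab : a < b) (hC : 0 < C) (hc : 0 < c)
    (hKδ : ∀ r Θ : ℝ, (r, Θ) ∈ K → δK < r ∧ δK < Θ)
    (hpack : ∀ d : StrongPointData, (d.r, d.Θ) ∈ K → d.Bounded M → d.MassEq → d.TemperatureEq (EulerEOS.monatomicExcess χe f) →
      d.MomentumEq (EulerEOS.monatomicExcess χe f) → ∀ U : ℝ × V3 × ℝ, 0 ≤ U.1 → 0 ≤ U.2.2 → ‖U.2.1‖ ^ 2 ≤ 2 * U.1 * U.2.2 →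
      rawRHS (EulerEOS.monatomicExcess χe f) (if 0 < 2 / 3 * (U.2.2 / U.1 - ‖U.2.1‖ ^ 2 / (2 * U.1 ^ 2)) then clamp a b else fun _ => a) d U.1 (U.2.2 - ‖U.2.1‖ ^ 2 / (2 * U.1)) U.2.1 + divPU (EulerEOS.monatomicExcess χe f) d ≤
          C * d.relEnergyZ (EulerEOS.monatomicExcess χe f) (if 0 < 2 / 3 * (U.2.2 / U.1 - ‖U.2.1‖ ^ 2 / (2 * U.1 ^ 2)) then clamp a b else fun _ => a) (U.1, U.2.2 - ‖U.2.1‖ ^ 2 / (2 * U.1), U.2.1) ∧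
        0 ≤ d.relEnergyZ (EulerEOS.monatomicExcess χe f) (if 0 < 2 / 3 * (U.2.2 / U.1 - ‖U.2.1‖ ^ 2 / (2 * U.1 ^ 2)) then clamp a b else fun _ => a) (U.1, U.2.2 - ‖U.2.1‖ ^ 2 / (2 * U.1), U.2.1) ∧
        (0 < U.1 → |U.1 - d.r| ≤ δK → |stateTemp (EulerEOS.monatomicExcess χe f) U.1 (U.2.2 - ‖U.2.1‖ ^ 2 / (2 * U.1)) - d.Θ| ≤ δK →
          c * ((U.1 - d.r) ^ 2 + (stateTemp (EulerEOS.monatomicExcess χe f) U.1 (U.2.2 - ‖U.2.1‖ ^ 2 / (2 * U.1)) - d.Θ) ^ 2) +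
            (∑ i, (U.2.1 i - U.1 * d.U i) ^ 2) / (2 * U.1) ≤ d.relEnergyZ (EulerEOS.monatomicExcess χe f) (if 0 < 2 / 3 * (U.2.2 / U.1 - ‖U.2.1‖ ^ 2 / (2 * U.1 ^ 2)) then clamp a b else fun _ => a) (U.1, U.2.2 - ‖U.2.1‖ ^ 2 / (2 * U.1), U.2.1)) ∧
        (¬(0 < U.1 ∧ |U.1 - d.r| ≤ δK ∧ |stateTemp (EulerEOS.monatomicExcess χe f) U.1 (U.2.2 - ‖U.2.1‖ ^ 2 / (2 * U.1)) - d.Θ| ≤ δK) →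
          c * (1 + U.1 + U.2.2 + (∑ i, (U.2.1 i - U.1 * d.U i) ^ 2) / (2 * U.1)) ≤
            d.relEnergyZ (EulerEOS.monatomicExcess χe f) (if 0 < 2 / 3 * (U.2.2 / U.1 - ‖U.2.1‖ ^ 2 / (2 * U.1 ^ 2)) then clamp a b else fun _ => a) (U.1, U.2.2 - ‖U.2.1‖ ^ 2 / (2 * U.1), U.2.1)))
    {V : ℝ → T3 → ℝ × V3 × ℝ} (hV : Measurable (Function.uncurry V)) {CV : ℝ}
    (hCV : ∀ s x, |(V s x).1| ≤ CV ∧ ‖(V s x).2.1‖ ≤ CV ∧ |(V s x).2.2| ≤ CV)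
    (hV0 : ∀ s x, 0 ≤ (V s x).1) (hVE : ∀ s x, 0 ≤ (V s x).2.2) (hVm : ∀ s x, ‖(V s x).2.1‖ ^ 2 ≤ 2 * (V s x).1 * (V s x).2.2)
    {δ : ℝ} (hδ0 : 0 ≤ δ) (hδ1 : δ ≤ 1)
    (H1 : ∀ φ : ℝ → T3 → ℝ, ContDiff ℝ 1 (Torus.stLift φ) → ∀ τ ∈ Set.Icc 0 t,
      (∫ x, φ τ x * (V τ x).1) - ∫ x, φ 0 x * (V 0 x).1 =
        ∫ s in Set.Icc 0 τ, ∫ x, (deriv (fun s' => φ s' x) s * (V s x).1 + ∑ k : Fin 3, (V s x).2.1 k * Torus.partialDeriv k (φ s) x))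
    (H4 : ∀ τ ∈ Set.Icc 0 t, ∫ x, (V τ x).2.2 ≤ (∫ x, (V 0 x).2.2) + δ)
    (H5 : ∀ x, |(V 0 x).1 - ρ 0 x| ≤ δ ∧ ‖(V 0 x).2.1 - ρ 0 x • u 0 x‖ ≤ δ ∧ |(V 0 x).2.2 - totalEnergyDensity (ρ 0 x) (u 0 x) (θ 0 x)| ≤ δ)
    {κ η : ℝ} (hδη : δ ≤ η)
    (hinit : ∀ d : StrongPointData, (d.r, d.Θ) ∈ K → d.Bounded M → ∀ (r E : ℝ) (m : V3), |r - d.r| ≤ η → ‖m - d.r • d.U‖ ≤ η →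
      |(‖m‖ ^ 2 / (2 * r) + E) - (d.r * ‖d.U‖ ^ 2 / 2 + d.r * (EulerEOS.monatomicExcess χe f).e d.r d.Θ)| ≤ η →
      0 < r ∧ 0 < E ∧ d.relEnergyZ (EulerEOS.monatomicExcess χe f) (clamp a b) (r, E, m) ≤ κ) :
    ∃ Fm : ℝ → ℝ, Measurable Fm ∧ (∀ s ∈ Set.Icc 0 t, Fm s = ∫ x, (pdAt T ρ u θ (s, x)).relEnergyZ (EulerEOS.monatomicExcess χe f) (if 0 < 2 / 3 * ((V s x).2.2 / (V s x).1 - ‖(V s x).2.1‖ ^ 2 / (2 * (V s x).1 ^ 2)) then clamp a b else fun _ => a) ((V s x).1, (V s x).2.2 - ‖(V s x).2.1‖ ^ 2 / (2 * (V s x).1), (V s x).2.1)) ∧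
      (∀ s ∈ Set.Icc 0 t, 0 ≤ Fm s) ∧ (∀ s ∈ Set.Icc 0 t, Fm s ≤ ((1 + 3 * M) * (P * (P ^ 2 / 2 + 3 / 2 * P) + 2) + (3 * M + N + N * max |a| |b|) * (P + 1) + N)) ∧ Fm 0 ≤ κ := by
  -- hypotheses of the common header of the three core lemmas that part A does not use
  have _ := hB; have _ := hP1; have _ := hδK; have _ := hC; have _ := hc; have _ := hKδ; have _ := hδ0
  clear hB hP1 hδK hC hc hKδ hδ0
  -- (0) the measurable version on `[0, t'] ⊇ [0, t]`
  obtain ⟨Fm, hFm, hFmeq⟩ := ChaosClosesEulerShellFieldC.exists_measurable_relEnergy hχc hfc hcl ht'T hV hV0 hVE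
    hVm hCV hM hN hab.le
  have hsub : ∀ s ∈ Icc 0 t, s ∈ Icc 0 t' := fun s hs => ⟨hs.1, hs.2.trans htt'.le⟩
  have h0t : (0 : ℝ) ∈ Icc 0 t := ⟨le_rfl, ht0.le⟩
  have h0' : (0 : ℝ) ∈ Icc 0 t' := hsub 0 h0t
  have h0T : (0 : ℝ) ∈ Ico 0 T := ⟨le_rfl, h0'.2.trans_lt ht'T⟩
  -- pointwise sign of `ℰ` on `[0, t']`
  have hnn : ∀ s ∈ Icc 0 t', ∀ x, 0 ≤ (pdAt T ρ u θ (s, x)).relEnergyZ (EulerEOS.monatomicExcess χe f)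
      (if 0 < 2 / 3 * ((V s x).2.2 / (V s x).1 - ‖(V s x).2.1‖ ^ 2 / (2 * (V s x).1 ^ 2)) then clamp a b
        else fun _ => a) ((V s x).1, (V s x).2.2 - ‖(V s x).2.1‖ ^ 2 / (2 * (V s x).1), (V s x).2.1) := by
    intro s hs x
    have hsT : s ∈ Ico 0 T := ⟨hs.1, hs.2.trans_lt ht'T⟩
    obtain ⟨h1, h2, h3⟩ := ChaosClosesEulerShellData.pointEqs hcl hG hsT x
    exact (hpack (pdAt T ρ u θ (s, x)) (hmemK s hs x) (hM s hs x) h1 h2 h3 (V s x) (hV0 s x) (hVE s x)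
      (hVm s x)).2.1
  refine ⟨Fm, hFm, fun s hs => hFmeq s (hsub s hs), fun s hs => ?_, fun s hs => ?_, ?_⟩
  · -- (1) sign
    rw [hFmeq s (hsub s hs)]
    exact integral_nonneg fun x => hnn s (hsub s hs) x
  · -- (2) universal bound
    have hs' := hsub s hs
    have hVs : Measurable fun x => V s x := hV.comp measurable_prodMk_left
    have iρ : Integrable fun x => (V s x).1 :=
      ChaosClosesEulerShellMeas.integrable_of_abs_le hVs.fst fun x => (hCV s x).1
    have iE : Integrable fun x => (V s x).2.2 :=
      ChaosClosesEulerShellMeas.integrable_of_abs_le hVs.snd.snd fun x => (hCV s x).2.2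
    -- mass: `∫ϱ(s) = ∫ϱ(0) ≤ P + 1`
    have hρ0 : ∫ x, (V 0 x).1 ≤ P + 1 := by
      refine integral_le_of_norm_le fun x => ?_
      rw [Real.norm_eq_abs, abs_of_nonneg (hV0 0 x)]
      have h5 := (abs_le.1 (H5 x).1).2
      have hρP := (le_abs_self _).trans (hρb 0 h0' x)
      linarith
    have hXr : ∫ x, (V s x).1 ≤ P + 1 := by
      rw [ChaosClosesEulerShellGlue.stub_bf18ShellGlue V t H1 s hs]; exact hρ0
    -- energy: `∫E(s) ≤ ∫E(0) + δ ≤ P(P²/2 + 3P/2) + 2`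
    have hE0 : ∫ x, (V 0 x).2.2 ≤ P * (P ^ 2 / 2 + 3 / 2 * P) + δ := by
      refine integral_le_of_norm_le fun x => ?_
      rw [Real.norm_eq_abs, abs_of_nonneg (hVE 0 x)]
      have h5 := (abs_le.1 (H5 x).2.2).2
      have hT : totalEnergyDensity (ρ 0 x) (u 0 x) (θ 0 x) ≤ P * (P ^ 2 / 2 + 3 / 2 * P) :=
        totalEnergyDensity_le (hcl.density_pos 0 h0T x).le ((le_abs_self _).trans (hρb 0 h0' x)) (hub 0 h0' x)
          (hcl.temperature_pos 0 h0T x).le ((le_abs_self _).trans (hθb 0 h0' x))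
      linarith
    have hXE : ∫ x, (V s x).2.2 ≤ P * (P ^ 2 / 2 + 3 / 2 * P) + 2 := by
      have h4 := H4 s hs; linarith
    -- the momentum-tested piece: `|∫ ũ·m| ≤ 3M (∫ϱ + ∫E)`
    have hXI : |∫ x, ⟪u s x, (V s x).2.1⟫_ℝ| ≤ 3 * M * ((∫ x, (V s x).1) + ∫ x, (V s x).2.2) := by
      rw [← integral_add iρ iE]
      refine abs_integral_le_const_mul (iρ.fun_add iE) fun x => ?_
      rw [Real.norm_eq_abs]
      have e : ⟪u s x, (V s x).2.1⟫_ℝ = ∑ i, (V s x).2.1 i * u s x i := by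
        rw [ChaosClosesEulerShellSlice.inner_eq_sum_mul]; exact Finset.sum_congr rfl fun i _ => mul_comm _ _
      rw [e]
      exact ChaosClosesEulerShellSlice.abs_sum_mom_mul_le (hM s hs' x).2.2.1 _ (hV0 s x) (hVE s x) (hVm s x)
    -- the continuity-tested piece: `|∫ φ₁ ϱ| ≤ N ∫ϱ`
    have hXT : |∫ x, energyTestFunction (EulerEOS.monatomicExcess χe f) ρ u θ s x * (V s x).1| ≤
        N * ∫ x, (V s x).1 := by
      refine abs_integral_le_const_mul iρ fun x => ?_
      rw [Real.norm_eq_abs, abs_mul, abs_of_nonneg (hV0 s x)]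
      exact mul_le_mul_of_nonneg_right (hN s hs' x).1 (hV0 s x)
    -- the entropy-tested piece: `|∫ θ̃ ϱ Zs| ≤ N max|a||b| ∫ϱ`
    have hXZ : |∫ x, θ s x * ((V s x).1 *
        (if 0 < 2 / 3 * ((V s x).2.2 / (V s x).1 - ‖(V s x).2.1‖ ^ 2 / (2 * (V s x).1 ^ 2)) then
          max a (min (3 / 2 * Real.log (2 / 3 * ((V s x).2.2 / (V s x).1 - ‖(V s x).2.1‖ ^ 2 / (2 * (V s x).1 ^ 2))) -
            Real.log (V s x).1 - f (V s x).1) b) else a))| ≤ N * max |a| |b| * ∫ x, (V s x).1 := by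
      refine abs_integral_le_const_mul iρ fun x => ?_
      have hZs : |(if 0 < 2 / 3 * ((V s x).2.2 / (V s x).1 - ‖(V s x).2.1‖ ^ 2 / (2 * (V s x).1 ^ 2)) then
          max a (min (3 / 2 * Real.log (2 / 3 * ((V s x).2.2 / (V s x).1 - ‖(V s x).2.1‖ ^ 2 / (2 * (V s x).1 ^ 2))) -
            Real.log (V s x).1 - f (V s x).1) b) else a)| ≤ max |a| |b| := by
        rw [← ChaosClosesEulerShellSlice.cutoff_shell χe f a b (V s x)]
        exact ChaosClosesEulerShellSlice.abs_cutoffSel_le hab.le _ _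
      have hΘ : |θ s x| ≤ N := (hN s hs' x).2.2.1
      rw [Real.norm_eq_abs, abs_mul, abs_mul, abs_of_nonneg (hV0 s x)]
      calc |θ s x| * ((V s x).1 * |(if 0 < 2 / 3 * ((V s x).2.2 / (V s x).1 - ‖(V s x).2.1‖ ^ 2 / (2 * (V s x).1 ^ 2)) then
          max a (min (3 / 2 * Real.log (2 / 3 * ((V s x).2.2 / (V s x).1 - ‖(V s x).2.1‖ ^ 2 / (2 * (V s x).1 ^ 2))) -
            Real.log (V s x).1 - f (V s x).1) b) else a)|)
          ≤ N * ((V s x).1 * max |a| |b|) :=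
            mul_le_mul hΘ (mul_le_mul_of_nonneg_left hZs (hV0 s x)) (mul_nonneg (hV0 s x) (abs_nonneg _)) hN0
        _ = N * max |a| |b| * (V s x).1 := by ring
    -- the pressure: `|∫ p̃| ≤ N`
    have hXP : |∫ x, (EulerEOS.monatomicExcess χe f).p (ρ s x) (θ s x)| ≤ N :=
      abs_integral_le_of_norm_le fun x => by rw [Real.norm_eq_abs]; exact (hN s hs' x).2.1
    rw [hFmeq s hs', ChaosClosesEulerShellFieldC.integral_relEnergy_split hχc hfc hcl ht'T hV hV0 hVE hVm hCV hM
      hN hab.le hs']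
    exact split_bound hM0 hN0 (le_max_of_le_left (abs_nonneg a)) hXI hXT hXZ hXP hXE hXr
  · -- (3) initial value
    rw [hFmeq 0 h0']
    refine integral_le_of_norm_le fun x => ?_
    rw [Real.norm_eq_abs, abs_of_nonneg (hnn 0 h0' x)]
    have hr : (pdAt T ρ u θ (0, x)).r = ρ 0 x := rfl
    have hU : (pdAt T ρ u θ (0, x)).U = u 0 x := rfl
    have hΘ : (pdAt T ρ u θ (0, x)).Θ = θ 0 x := rfl
    have h3 : |(‖(V 0 x).2.1‖ ^ 2 / (2 * (V 0 x).1) + ((V 0 x).2.2 - ‖(V 0 x).2.1‖ ^ 2 / (2 * (V 0 x).1))) -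
        ((pdAt T ρ u θ (0, x)).r * ‖(pdAt T ρ u θ (0, x)).U‖ ^ 2 / 2 +
          (pdAt T ρ u θ (0, x)).r * (EulerEOS.monatomicExcess χe f).e (pdAt T ρ u θ (0, x)).r
            (pdAt T ρ u θ (0, x)).Θ)| ≤ η := by
      have e : (‖(V 0 x).2.1‖ ^ 2 / (2 * (V 0 x).1) + ((V 0 x).2.2 - ‖(V 0 x).2.1‖ ^ 2 / (2 * (V 0 x).1))) -
          ((pdAt T ρ u θ (0, x)).r * ‖(pdAt T ρ u θ (0, x)).U‖ ^ 2 / 2 +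
            (pdAt T ρ u θ (0, x)).r * (EulerEOS.monatomicExcess χe f).e (pdAt T ρ u θ (0, x)).r
              (pdAt T ρ u θ (0, x)).Θ) =
          (V 0 x).2.2 - totalEnergyDensity (ρ 0 x) (u 0 x) (θ 0 x) := by
        rw [hr, hU, hΘ]
        simp only [totalEnergyDensity, EulerEOS.monatomicExcess]
        ring
      rw [e]
      exact (H5 x).2.2.trans hδη
    obtain ⟨hrpos, hEpos, hκ⟩ := hinit (pdAt T ρ u θ (0, x)) (hmemK 0 h0' x) (hM 0 h0' x) (V 0 x).1
      ((V 0 x).2.2 - ‖(V 0 x).2.1‖ ^ 2 / (2 * (V 0 x).1)) (V 0 x).2.1 (((H5 x).1).trans hδη)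
      (((H5 x).2.1).trans hδη) h3
    have hθo : 0 < 2 / 3 * ((V 0 x).2.2 / (V 0 x).1 - ‖(V 0 x).2.1‖ ^ 2 / (2 * (V 0 x).1 ^ 2)) := by
      rw [← ChaosClosesEulerShellSlice.stateTemp_shell χe f (V 0 x)]
      simp only [stateTemp, EulerEOS.monatomicExcess]
      positivity
    rw [if_pos hθo]
    exact hκ

/-! ## The registered sub-goal -/

/-- REGISTERED SUB-GOAL `stub_bf18ShellCoreA` of the line `Sketch` (BF18 shell assembly, core lemma A): the
a-priori level `C₂ = (1 + 3M)(P(P²/2 + 3P/2) + 2) + (3M + N + N·max|a||b|)(P + 1) + N` of the slice functional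
is non-negative for `M, N ≥ 0`, `P ≥ 1`. [folklore] -/
theorem stub_bf18ShellCoreA : ∀ (M P N a b : ℝ), 0 ≤ M → 1 ≤ P → 0 ≤ N → 0 ≤ (1 + 3 * M) * (P * (P ^ 2 / 2 + 3 / 2 * P) + 2) + (3 * M + N + N * max |a| |b|) * (P + 1) + N := by
  intro M P N a b hM hP hN
  have hP0 : 0 < P := by linarith
  have hZb : 0 ≤ max |a| |b| := le_max_of_le_left (abs_nonneg a)
  positivity

end Summit.AtomisticToContinuum.HydrodynamicLimit.Theorems.ChaosClosesEulerShellCoreA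

end
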